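import Summits.HubbardSuperconductivity.HubbardSuperconductivity.Theorems.AnisotropyChordTransferFibre3Hole2FastSound

/-!
# Route `AnisotropyChord` / H0 rotor rung: HOLE₂ per-`L` certificates — the QUARTER Green table (evenness of `Re G̃` in each coordinate)

Third computable layer + its soundness.  `Re G̃_g(r₁,r₂)` is even in each coordinate separately (reindex `k₁ ↦ −k₁`, resp.
`k₂ ↦ −k₂`: `ε` is even and the phase `k·r` is unchanged mod `L` — `gterm_reflect₁/₂`, `greenRe_even₁/₂`), so the Green table need
only be built on the quarter `0 ≤ r₁, r₂ ≤ L/2` (`gTabQ`, from the half inner table `cTabH`): `≈ ¾L³` interval operations instead of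
`2L³` (`…Fibre3Hole2Fast`), and a pair reads its `10 × 10` matrix through the fold `r ↦ min(r, L − r)` (`gMatQ`).  The rest of the
pipeline is `checkPairG` of `…Fibre3Hole2Fast`; `gEncl_Q` feeds the generic soundness `twoHoleGapRealAt_of_cert` (`…Hole2Cert`), and
★ `twoHoleGap_of_checkRepsQ`: `checkRepsQ L reps = true` + `D₄`-coverage ⇒ `TwoHoleGap L (3/4·eps1 L)`.
Prover seat `hubbard-h0-rotor-p3` g3; helper for stmt-HubbardSuperconductivity-19089 (`--supports`, helper class).
WHAT THIS IS NOT: nothing here proves superconductivity in the Hubbard model (rotor TARGET as worded stays FALSE, g15 verdict);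
per-`L` certificates for ONE input (HOLE₂) of ONE conditional reduction (rung 19089). Tree imports only; no sorry, no `native_decide`.
-/

set_option linter.dupNamespace false
set_option autoImplicit false

namespace Summit.HubbardSuperconductivity.HubbardSuperconductivity.Theorems.AnisotropyChord.Transfer.Fibre3

namespace Hole2

open scoped BigOperators
open Finset

/-! ## Computable layer -/

/-- fold a residue to the representative of `±r` in `[0, L/2]`. [folklore] -/
def foldR (L r : ℕ) : ℕ := min (r % L) (L - r % L)

/-- the HALF inner table `C(k₁, r₂)`, rows `k₁ < L`, columns `r₂ ≤ L/2`. [folklore] -/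
def cTabH (L : ℕ) (ct : List Iv) (et : List (List Iv)) : List (List Iv) :=
  (List.range L).map fun k1 => (List.range (L / 2 + 1)).map fun r2 => cRow L ct (et.getD k1 []) k1 r2 L

/-- the QUARTER Green table, `r₁, r₂ ≤ L/2` (outer sums read the half inner table). [folklore] -/
def gTabQ (L : ℕ) (ct : List Iv) (ctabH : List (List Iv)) : List (List Iv) :=
  (List.range (L / 2 + 1)).map fun r1 => (List.range (L / 2 + 1)).map fun r2 => greenIvT L ct ctabH r1 r2

/-- the quarter Green table at `L` for the certified constant `g_L`. [folklore] -/
def gTabQL (L : ℕ) : List (List Iv) :=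
  gTabQ L (cosTab L) (cTabH L (cosTab L) (einvTab L (cosTab L) (gFix L)))

/-- the pair's `10 × 10` interval Green matrix read off the quarter table through the fold. [folklore] -/
def gMatQ (L : ℕ) (gt : List (List Iv)) (s1 s2 : ℕ) : List (List Iv) :=
  (List.range 10).map fun p => (List.range 10).map fun q =>
    getIv (gt.getD (foldR L ((slotPt L s1 s2 p).1 + (L - (slotPt L s1 s2 q).1))) [])
      (foldR L ((slotPt L s1 s2 p).2 + (L - (slotPt L s1 s2 q).2)))

/-- ★ QUARTER-TABLE CHECK of a list of separations: parameters, one quarter table, then every pair (`checkPairG`). [folklore] -/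
def checkRepsQ (L : ℕ) (reps : List (ℕ × ℕ)) : Bool :=
  let gt := gTabQL L
  checkParams L && reps.all fun s => checkPairG L (gMatQ L gt s.1 s.2) s.1 s.2

/-! ## Evenness of `Re G̃` in each coordinate -/

/-- `cos(2πx/L)` depends on `x mod L` only. [folklore] -/
theorem cos_congr_mod (L : ℕ) (hL : 0 < L) {x y : ℕ} (h : x % L = y % L) :
    Real.cos (2 * Real.pi * x / L) = Real.cos (2 * Real.pi * y / L) := by
  rw [cos_mod L hL x, cos_mod L hL y, h]

/-- reflected residues multiply like the originals: `(L − a)·(L − b) ≡ a·b (mod L)` in the form used by the tables. [folklore] -/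
theorem reflect_mul_mod (L : ℕ) {a b : ℕ} (ha : a < L) (hb : b < L) :
    ((L - a) % L * ((L - b) % L)) % L = (a * b) % L := by
  rw [← ZMod.natCast_eq_natCast_iff']
  push_cast [ZMod.natCast_mod, Nat.cast_sub ha.le, Nat.cast_sub hb.le, ZMod.natCast_self]
  ring

/-- `ε` is even in the first momentum (reflected residue form). [folklore] -/
theorem epsN_reflect₁ (L : ℕ) (hL : 0 < L) {k1 : ℕ} (hk1 : k1 < L) (k2 : ℕ) : epsN L ((L - k1) % L) k2 = epsN L k1 k2 := by
  unfold epsN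
  rw [cos_congr_mod L hL (x := (L - k1) % L) (y := L - k1) (Nat.mod_mod _ _)]
  by_cases h0 : k1 = 0
  · subst h0; rw [Nat.sub_zero, cos_congr_mod L hL (x := L) (y := 0) (by simp)]
  · have := epsN_reflect L (k1 := k1) (k2 := k1) (Nat.pos_of_ne_zero h0) hk1
    -- reuse the second-coordinate evenness through the symmetric form of `epsN`
    unfold epsN at this
    have e : Real.cos (2 * Real.pi * ((L - k1 : ℕ) : ℝ) / L) = Real.cos (2 * Real.pi * k1 / L) := by linarith
    rw [e]

/-- ★ the Green summand is invariant under the simultaneous reflection `k₁ ↦ L − k₁`, `r₁ ↦ L − r₁`. [folklore] -/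
theorem gterm_reflect₁ (L : ℕ) (hL : 0 < L) (g : ℝ) {r1 k1 : ℕ} (hr1 : r1 < L) (hk1 : k1 < L) (r2 k2 : ℕ) :
    gterm L g ((L - r1) % L) r2 ((L - k1) % L) k2 = gterm L g r1 r2 k1 k2 := by
  unfold gterm
  have hz : ((L - k1) % L = 0) ↔ k1 = 0 := by
    constructor
    · intro h
      by_contra hne
      have : (L - k1) % L = L - k1 := Nat.mod_eq_of_lt (by omega)
      omega
    · rintro rfl; simp
  by_cases hk : k1 = 0 ∧ k2 = 0
  · rw [if_pos hk, if_pos ⟨hz.mpr hk.1, hk.2⟩]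
  · rw [if_neg hk, if_neg (fun h => hk ⟨hz.mp h.1, h.2⟩), epsN_reflect₁ L hL hk1]
    congr 1
    apply cos_congr_mod L hL
    rw [Nat.mod_mod, Nat.mod_mod, Nat.add_mod, reflect_mul_mod L hk1 hr1, ← Nat.add_mod]

/-- ★ the Green summand is invariant under `k₂ ↦ L − k₂`, `r₂ ↦ L − r₂`. [folklore] -/
theorem gterm_reflect₂ (L : ℕ) (hL : 0 < L) (g : ℝ) (r1 k1 : ℕ) {r2 k2 : ℕ} (hr2 : r2 < L) (hk2 : k2 < L) :
    gterm L g r1 ((L - r2) % L) k1 ((L - k2) % L) = gterm L g r1 r2 k1 k2 := by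
  unfold gterm
  have hz : ((L - k2) % L = 0) ↔ k2 = 0 := by
    constructor
    · intro h
      by_contra hne
      have : (L - k2) % L = L - k2 := Nat.mod_eq_of_lt (by omega)
      omega
    · rintro rfl; simp
  have he : epsN L k1 ((L - k2) % L) = epsN L k1 k2 := by
    have h1 := epsN_reflect₁ L hL hk2 k1
    unfold epsN at h1 ⊢
    linarith
  by_cases hk : k1 = 0 ∧ k2 = 0
  · rw [if_pos hk, if_pos ⟨hk.1, hz.mpr hk.2⟩]
  · rw [if_neg hk, if_neg (fun h => hk ⟨h.1, hz.mp h.2⟩), he]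
    congr 1
    apply cos_congr_mod L hL
    rw [Nat.mod_mod, Nat.mod_mod, Nat.add_mod, reflect_mul_mod L hk2 hr2, ← Nat.add_mod]

/-- reindexing a `range L` sum along the reflection `k ↦ (L − k) mod L`. [folklore] -/
theorem sum_range_reflect (L : ℕ) (hL : 0 < L) (F : ℕ → ℝ) :
    ∑ k ∈ range L, F ((L - k) % L) = ∑ k ∈ range L, F k := by
  refine Finset.sum_nbij' (fun k => (L - k) % L) (fun k => (L - k) % L) ?_ ?_ ?_ ?_ ?_
  · intro k _; exact mem_range.mpr (Nat.mod_lt _ hL)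
  · intro k _; exact mem_range.mpr (Nat.mod_lt _ hL)
  · intro k hk
    rw [mem_range] at hk
    by_cases h0 : k = 0
    · subst h0; simp
    · rw [Nat.mod_eq_of_lt (show L - k < L by omega), show L - (L - k) = k by omega, Nat.mod_eq_of_lt hk]
  · intro k hk
    rw [mem_range] at hk
    by_cases h0 : k = 0
    · subst h0; simp
    · rw [Nat.mod_eq_of_lt (show L - k < L by omega), show L - (L - k) = k by omega, Nat.mod_eq_of_lt hk]
  · intro k _; rfl

/-- `Re G̃` is even in the first coordinate. [folklore] -/
theorem greenRe_even₁ (L : ℕ) [NeZero L] (g : ℝ) {r1 r2 : ℕ} (h1 : r1 < L) (h2 : r2 < L) :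
    (TwoHoleBS.greenW L g ((((L - r1) % L : ℕ) : ZMod L), ((r2 : ℕ) : ZMod L))).re
      = (TwoHoleBS.greenW L g (((r1 : ℕ) : ZMod L), ((r2 : ℕ) : ZMod L))).re := by
  have hL : 0 < L := Nat.pos_of_ne_zero (NeZero.ne L)
  rw [greenW_re_eq L g (Nat.mod_lt _ hL) h2, greenW_re_eq L g h1 h2]
  congr 1
  rw [← sum_range_reflect L hL (fun k1 => ∑ k2 ∈ range L, gterm L g ((L - r1) % L) r2 k1 k2)]
  refine Finset.sum_congr rfl fun k1 hk1 => Finset.sum_congr rfl fun k2 _ => ?_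
  exact gterm_reflect₁ L hL g h1 (mem_range.mp hk1) r2 k2

/-- `Re G̃` is even in the second coordinate. [folklore] -/
theorem greenRe_even₂ (L : ℕ) [NeZero L] (g : ℝ) {r1 r2 : ℕ} (h1 : r1 < L) (h2 : r2 < L) :
    (TwoHoleBS.greenW L g (((r1 : ℕ) : ZMod L), (((L - r2) % L : ℕ) : ZMod L))).re
      = (TwoHoleBS.greenW L g (((r1 : ℕ) : ZMod L), ((r2 : ℕ) : ZMod L))).re := by
  have hL : 0 < L := Nat.pos_of_ne_zero (NeZero.ne L)
  rw [greenW_re_eq L g h1 (Nat.mod_lt _ hL), greenW_re_eq L g h1 h2]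
  congr 1
  refine Finset.sum_congr rfl fun k1 _ => ?_
  rw [← sum_range_reflect L hL (fun k2 => gterm L g r1 ((L - r2) % L) k1 k2)]
  refine Finset.sum_congr rfl fun k2 hk2 => ?_
  exact gterm_reflect₂ L hL g r1 k1 h2 (mem_range.mp hk2)

/-- the fold keeps the value of `Re G̃` (first coordinate). [folklore] -/
theorem greenRe_fold₁ (L : ℕ) [NeZero L] (g : ℝ) (x : ℕ) {r2 : ℕ} (h2 : r2 < L) :
    (TwoHoleBS.greenW L g (((foldR L x : ℕ) : ZMod L), ((r2 : ℕ) : ZMod L))).re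
      = (TwoHoleBS.greenW L g (((x % L : ℕ) : ZMod L), ((r2 : ℕ) : ZMod L))).re := by
  have hL : 0 < L := Nat.pos_of_ne_zero (NeZero.ne L)
  unfold foldR
  rcases min_choice (x % L) (L - x % L) with h | h
  · rw [h]
  · rw [h]
    have e : (L - x % L) = (L - x % L) % L ∨ x % L = 0 := by
      by_cases h0 : x % L = 0
      · exact Or.inr h0
      · exact Or.inl (Nat.mod_eq_of_lt (by have := Nat.mod_lt x hL; omega)).symm
    rcases e with e | e
    · rw [e]; exact greenRe_even₁ L g (Nat.mod_lt _ hL) h2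
    · rw [e, Nat.sub_zero]
      have : ((L : ℕ) : ZMod L) = ((0 : ℕ) : ZMod L) := by simp
      rw [this]

/-- the fold keeps the value of `Re G̃` (second coordinate). [folklore] -/
theorem greenRe_fold₂ (L : ℕ) [NeZero L] (g : ℝ) {r1 : ℕ} (h1 : r1 < L) (y : ℕ) :
    (TwoHoleBS.greenW L g (((r1 : ℕ) : ZMod L), ((foldR L y : ℕ) : ZMod L))).re
      = (TwoHoleBS.greenW L g (((r1 : ℕ) : ZMod L), ((y % L : ℕ) : ZMod L))).re := by
  have hL : 0 < L := Nat.pos_of_ne_zero (NeZero.ne L)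
  unfold foldR
  rcases min_choice (y % L) (L - y % L) with h | h
  · rw [h]
  · rw [h]
    by_cases h0 : y % L = 0
    · rw [h0, Nat.sub_zero]
      have : ((L : ℕ) : ZMod L) = ((0 : ℕ) : ZMod L) := by simp
      rw [this]
    · have e : (L - y % L) = (L - y % L) % L := (Nat.mod_eq_of_lt (by have := Nat.mod_lt y hL; omega)).symm
      rw [e]; exact greenRe_even₂ L g h1 (Nat.mod_lt _ hL)

/-- the fold lands in `[0, L/2]`. [folklore] -/
theorem foldR_le (L : ℕ) (hL : 0 < L) (x : ℕ) : foldR L x ≤ L / 2 := by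
  unfold foldR
  have := Nat.mod_lt x hL
  rcases le_total (x % L) (L - x % L) with h | h
  · rw [min_eq_left h]; omega
  · rw [min_eq_right h]; omega

/-! ## The quarter table encloses `Re G̃` -/

/-- lookup in the half inner table. [folklore] -/
theorem getIv_cTabH {L : ℕ} (ct : List Iv) (et : List (List Iv)) {k1 r2 : ℕ} (hk1 : k1 < L) (hr2 : r2 < L / 2 + 1) :
    getIv ((cTabH L ct et).getD k1 []) r2 = cRow L ct (et.getD k1 []) k1 r2 L := by
  unfold cTabH getIv
  rw [getD_map_range _ _ hk1, getD_map_range _ _ hr2]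

/-- spine induction for the outer sum over the half inner table. [folklore] -/
theorem mem_gOuterH (L : ℕ) [NeZero L] (hL : 3 ≤ L) (hpos : epsPos L (cosTab L) (gFix L) = true) {r1 r2 : ℕ}
    (hr2 : r2 < L / 2 + 1) : ∀ n : ℕ, n ≤ L →
      mem (∑ k1 ∈ range n, Real.cos (2 * Real.pi * ((k1 * r1) % L : ℕ) / L) * ∑ k2 ∈ range L, cterm L (gR L) r2 k1 k2)
        (gOuter L (cosTab L) (cTabH L (cosTab L) (einvTab L (cosTab L) (gFix L))) r1 r2 n) := by
  have hL0 : 0 < L := by omega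
  intro n
  induction n with
  | zero =>
    intro _
    rw [Finset.sum_range_zero]
    have := mem_exact 0
    push_cast at this
    rw [zero_div] at this
    exact this
  | succ n ih =>
    intro hn
    rw [Finset.sum_range_succ]
    unfold gOuter
    have hm : (n * r1) % L < L := Nat.mod_lt _ hL0
    refine mem_iadd (ih (by omega)) ?_
    rw [getIv_cosTab hm, getIv_cTabH _ _ (show n < L from hn) hr2]
    exact mem_imul (mem_cosIv hL hm) (mem_cRow L hL hpos r2 (show n < L from hn) L le_rfl)

/-- ★ the quarter table encloses `Re G̃_{g_L}` on `r₁, r₂ ≤ L/2`. [folklore] -/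
theorem mem_gTabQL (L : ℕ) [NeZero L] (hL : 3 ≤ L) (hpos : epsPos L (cosTab L) (gFix L) = true) {r1 r2 : ℕ}
    (h1 : r1 < L / 2 + 1) (h2 : r2 < L / 2 + 1) :
    mem (TwoHoleBS.greenW L (gR L) (((r1 : ℕ) : ZMod L), ((r2 : ℕ) : ZMod L))).re (getIv ((gTabQL L).getD r1 []) r2) := by
  have hL0 : 0 < L := by omega
  have h1L : r1 < L := by omega
  have h2L : r2 < L := by omega
  unfold gTabQL gTabQ getIv
  rw [getD_map_range _ _ h1, getD_map_range _ _ h2, greenW_re_eq L (gR L) h1L h2L]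
  unfold greenIvT
  rw [Finset.sum_congr rfl fun k1 _ => gterm_row_separable L hL0 (gR L) r1 r2 k1]
  have hLL : (0 : ℤ) < (L : ℤ) * L := by
    have : (0 : ℤ) < L := by exact_mod_cast hL0
    positivity
  have h := mem_idivn (mem_gOuterH L hL hpos h2 L le_rfl (r1 := r1)) hLL
  push_cast at h
  rw [sq]
  exact h

/-- ★ the pair matrix read off the quarter table satisfies the enclosure hypothesis. [folklore] -/
theorem gEncl_Q (L : ℕ) [NeZero L] (hL : 3 ≤ L) (hpos : epsPos L (cosTab L) (gFix L) = true) (s1 s2 : ℕ) :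
    GEncl L s1 s2 (gMatQ L (gTabQL L) s1 s2) := by
  have hL0 : 0 < L := by omega
  intro p q hp hq
  unfold gMatQ getM getIv
  rw [getD_map_range _ _ hp, getD_map_range _ _ hq]
  unfold GR
  rw [ptT_sub L s1 s2 hL]
  have hf1 := foldR_le L hL0 ((slotPt L s1 s2 p).1 + (L - (slotPt L s1 s2 q).1))
  have hf2 := foldR_le L hL0 ((slotPt L s1 s2 p).2 + (L - (slotPt L s1 s2 q).2))
  have key := mem_gTabQL L hL hpos (Nat.lt_succ_of_le hf1) (Nat.lt_succ_of_le hf2)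
  rw [greenRe_fold₁ L (gR L) _ (by omega), greenRe_fold₂ L (gR L) (Nat.mod_lt _ hL0)] at key
  exact key

/-! ## Assembly -/

/-- splitting the list of separations. [folklore] -/
theorem checkRepsQ_append {L : ℕ} {A B : List (ℕ × ℕ)} (hA : checkRepsQ L A = true) (hB : checkRepsQ L B = true) :
    checkRepsQ L (A ++ B) = true := by
  unfold checkRepsQ at hA hB ⊢
  simp only [Bool.and_eq_true, List.all_append] at hA hB ⊢
  exact ⟨hA.1, hA.2, hB.2⟩

/-- ★ HOLE₂(.75) FROM THE QUARTER-TABLE CHECK: `checkRepsQ L reps = true` and `D₄`-coverage of the listed separations give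
`TwoHoleGap L (3/4·eps1 L)`. [folklore] -/
theorem twoHoleGap_of_checkRepsQ (L : ℕ) [NeZero L] (reps : List (ℕ × ℕ)) (h : checkRepsQ L reps = true)
    (hcover : ∀ z : Tor L, z ≠ 0 → ∃ s ∈ (reps.map fun ab => sT L ab.1 ab.2).toFinset, s ∈ d4Orbit L z) :
    TwoHoleGap L (3 / 4 * eps1 L) := by
  unfold checkRepsQ at h
  rw [Bool.and_eq_true] at h
  obtain ⟨hpar, hall⟩ := h
  have hpar' := hpar
  unfold checkParams at hpar'
  simp only [Bool.and_eq_true, decide_eq_true_eq] at hpar'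
  obtain ⟨⟨⟨⟨hL, _⟩, _⟩, hglt'⟩, hpos⟩ := hpar'
  rw [List.all_eq_true] at hall
  refine twoHoleGap_mono L (gFix_ge L hL) (twoHoleGap_of_reps L _ hcover fun s hs => ?_)
  rw [List.mem_toFinset, List.mem_map] at hs
  obtain ⟨ab, hab, rfl⟩ := hs
  obtain ⟨hne, hpsd⟩ := checkPairG_spec (hall ab hab)
  exact twoHoleGapRealAt_of_cert L ab.1 ab.2 hL hglt' hne _ (gEncl_Q L hL hpos ab.1 ab.2) _ hpsd

end Hole2

end Summit.HubbardSuperconductivity.HubbardSuperconductivity.Theorems.AnisotropyChord.Transfer.Fibre3
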